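import Mathlib
import HarnessLib

/-!
# Independent generators of a finite abelian group, and the order of a complemented group

Two counting lemmas on finite abelian groups, in the additive language used by the tree's
`Literature/GroupTheory/FiniteAbelian/` files (`AddSubgroup`, `Nat.card`, `addOrderOf`):

* `exists_indep_prod_addOrderOf_eq_card` — the structure theorem
  (`AddCommGroup.equiv_directSum_zmod_of_finite`: `G ≃ ⊕ ℤ/p_i^{e_i}`) read as: a finite abelian
  group has finitely many *independent* elements `g₀, …, g_{m-1}`
  (`∑ aᵢ gᵢ = 0 ⟹ aᵢ gᵢ = 0`) whose orders multiply to `#G`;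
* `card_eq_mul_of_isCompl` — complementary subgroups `H ⊓ K = ⊥`, `H ⊔ K = ⊤` of an abelian group
  have `#G = #H · #K` (the sum map `H × K → G` is bijective).

Used by `Literature/NumberTheory/EllipticCurves/HeegnerPointsKolyvaginPrimaryOrderProofs`
(Kolyvagin's bound on `#Ш(E/K)[p^∞]`, McCallum 1991 §5) to turn a maximal isotropic subgroup into
generators. No definition and no named fact.

## References

* Mathlib, `Mathlib.GroupTheory.FiniteAbelian.Basic` (`AddCommGroup.equiv_directSum_zmod_of_finite`).
* W. G. McCallum, *Kolyvagin's work on Shafarevich–Tate groups*, LMS Lecture Note Ser. 153 (1991),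
  295–316, §5 p. 312 ("a maximal isotropic subgroup `D = D₁ × D₂ × ⋯`, each `Dᵢ` cyclic").
  [McCallumLMS1991]
-/

namespace Literature.GroupTheory.FiniteAbelian

universe u

variable {G : Type u} [AddCommGroup G]

/-- The sum map `H × K → G` of two *disjoint* subgroups of an abelian group is injective. [folklore] -/
private theorem injective_sumMap_of_disjoint {H K : AddSubgroup G} (h : Disjoint H K) :
    Function.Injective (H.subtype.coprod K.subtype) := by
  rw [injective_iff_map_eq_zero]
  rintro ⟨a, b⟩ hab
  rw [AddMonoidHom.coprod_apply, AddSubgroup.coe_subtype, AddSubgroup.coe_subtype] at hab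
  have ha : (a : G) ∈ K := by
    have : (a : G) = -(b : G) := eq_neg_of_add_eq_zero_left hab
    rw [this]
    exact K.neg_mem b.2
  have ha0 : (a : G) = 0 := (AddSubgroup.disjoint_def.mp h) a.2 ha
  have hb0 : (b : G) = 0 := by rwa [ha0, zero_add] at hab
  ext <;> simp [ha0, hb0]

/-- **Complementary subgroups multiply orders**: if `H ⊓ K = ⊥` and `H ⊔ K = ⊤` in an abelian group
then `#G = #H · #K`. [cite: McCallumLMS1991, §5 p. 311 (the eigenspace decomposition)] -/
theorem card_eq_mul_of_isCompl {H K : AddSubgroup G} (h : IsCompl H K) :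
    Nat.card G = Nat.card H * Nat.card K := by
  have hsurj : Function.Surjective (H.subtype.coprod K.subtype) := by
    rw [← AddMonoidHom.range_eq_top, eq_top_iff]
    intro g _
    have hg : g ∈ H ⊔ K := h.codisjoint.eq_top ▸ AddSubgroup.mem_top g
    obtain ⟨a, ha, b, hb, rfl⟩ := AddSubgroup.mem_sup.mp hg
    exact ⟨(⟨a, ha⟩, ⟨b, hb⟩), rfl⟩
  rw [← Nat.card_prod]
  exact (Nat.card_congr (Equiv.ofBijective _
    ⟨injective_sumMap_of_disjoint h.disjoint, hsurj⟩)).symm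

/-- **Independent generators with multiplicative orders** (the structure theorem of finite abelian
groups, `G ≃ ⊕ᵢ ℤ/nᵢ`): there are `g₀, …, g_{m-1} ∈ G` (extended by `0`), independent
(`∑_{i<m} aᵢ gᵢ = 0 ⟹ aᵢ gᵢ = 0` for all `i < m`), with `∏_{i<m} ord gᵢ = #G`.
[cite: McCallumLMS1991, §5 p. 312] -/
theorem exists_indep_prod_addOrderOf_eq_card [Finite G] :
    ∃ (m : ℕ) (g : ℕ → G), (∀ i, m ≤ i → g i = 0) ∧
      (∀ a : ℕ → ℤ, ∑ i ∈ Finset.range m, a i • g i = 0 → ∀ i ∈ Finset.range m, a i • g i = 0) ∧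
      Nat.card G = ∏ i ∈ Finset.range m, addOrderOf (g i) := by
  classical
  obtain ⟨ι, _, p, hp, e, ⟨f⟩⟩ := AddCommGroup.equiv_directSum_zmod_of_finite G
  -- pass to plain functions `Π i, ZMod (p i ^ e i)`
  let f' : G ≃+ (Π i : ι, ZMod (p i ^ e i)) :=
    f.trans (DirectSum.linearEquivFunOnFintype ℤ ι (fun i ↦ ZMod (p i ^ e i))).toAddEquiv
  set m := Fintype.card ι with hm
  let σ : ι ≃ Fin m := Fintype.equivFin ι
  -- the generators `g k = f'⁻¹ (δ_{σ⁻¹ k})`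
  let g : ℕ → G := fun k ↦
    if h : k < m then f'.symm (Pi.single (σ.symm ⟨k, h⟩) 1) else 0
  have hg_of_lt : ∀ k (h : k < m), g k = f'.symm (Pi.single (σ.symm ⟨k, h⟩) 1) := fun k h ↦ by
    simp only [g, dif_pos h]
  refine ⟨m, g, fun i hi ↦ by simp only [g, dif_neg (not_lt.mpr hi)], fun a ha i hi ↦ ?_, ?_⟩
  · -- independence: evaluate `f' (∑ aₖ gₖ) = ∑ aₖ δ_{σ⁻¹ k}` at `σ⁻¹ i`
    rw [Finset.mem_range] at hi
    have h1 : f' (∑ k ∈ Finset.range m, a k • g k) = 0 := by rw [ha, map_zero]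
    rw [map_sum] at h1
    have h2 : ∀ k (hk : k < m),
        f' (a k • g k) = a k • Pi.single (σ.symm ⟨k, hk⟩) (1 : ZMod _) := by
      intro k hk
      rw [map_zsmul, hg_of_lt k hk, AddEquiv.apply_symm_apply]
    have h3 := congrFun h1 (σ.symm ⟨i, hi⟩)
    rw [Finset.sum_apply, Pi.zero_apply,
      Finset.sum_eq_single_of_mem i (Finset.mem_range.mpr hi)] at h3
    · rw [h2 i hi, Pi.smul_apply, Pi.single_eq_same] at h3
      -- `a i • 1 = 0` in `ZMod`, hence `a i • δ = 0`, hence `a i • g i = 0`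
      apply f'.injective
      rw [h2 i hi, map_zero, ← Pi.single_smul, h3, Pi.single_zero]
    · intro k hk hki
      rw [h2 k (Finset.mem_range.mp hk), Pi.smul_apply, Pi.single_eq_of_ne, smul_zero]
      intro heq
      apply hki
      have := congrArg Fin.val (σ.symm.injective heq)
      exact this.symm
  · -- orders: `#G = ∏ᵢ #ℤ/p_i^e_i = ∏ₖ ord gₖ`
    have hcard : Nat.card G = ∏ i : ι, p i ^ e i := by
      rw [Nat.card_congr f'.toEquiv, Nat.card_pi]
      exact Finset.prod_congr rfl fun i _ ↦ Nat.card_zmod _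
    have hord : ∀ k (h : k < m), addOrderOf (g k) = p (σ.symm ⟨k, h⟩) ^ e (σ.symm ⟨k, h⟩) := by
      intro k h
      rw [hg_of_lt k h, AddEquiv.addOrderOf_eq]
      have := addOrderOf_injective (AddMonoidHom.single (fun i ↦ ZMod (p i ^ e i)) (σ.symm ⟨k, h⟩))
        (fun x y hxy ↦ Pi.single_injective (M := fun i ↦ ZMod (p i ^ e i)) (σ.symm ⟨k, h⟩) hxy) 1
      rwa [AddMonoidHom.single_apply, ZMod.addOrderOf_one] at this
    rw [hcard, ← Fin.prod_univ_eq_prod_range (fun k ↦ addOrderOf (g k)) m,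
      ← Fintype.prod_equiv σ.symm (fun k : Fin m ↦ addOrderOf (g k))
        (fun i : ι ↦ p i ^ e i) (fun k ↦ ?_)]
    rw [hord k.1 k.2]

/-- `exists_indep_prod_addOrderOf_eq_card` with the length padded to any `m' ≥ m` (the extra
generators are `0`, of order `1`). [cite: McCallumLMS1991, §5 p. 312] -/
theorem exists_indep_prod_addOrderOf_eq_card_le [Finite G] :
    ∃ (m : ℕ) (g : ℕ → G), ∀ m', m ≤ m' →
      (∀ a : ℕ → ℤ, ∑ i ∈ Finset.range m', a i • g i = 0 → ∀ i ∈ Finset.range m', a i • g i = 0) ∧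
      Nat.card G = ∏ i ∈ Finset.range m', addOrderOf (g i) := by
  obtain ⟨m, g, hg0, hind, hcard⟩ := exists_indep_prod_addOrderOf_eq_card (G := G)
  refine ⟨m, g, fun m' hm' ↦ ⟨fun a ha i hi ↦ ?_, ?_⟩⟩
  · have hsplit : ∑ i ∈ Finset.range m', a i • g i = ∑ i ∈ Finset.range m, a i • g i := by
      rw [← Finset.sum_range_add_sum_Ico _ hm', Finset.sum_eq_zero (s := Finset.Ico m m'), add_zero]
      intro i hi
      rw [hg0 i (Finset.mem_Ico.mp hi).1, smul_zero]
    by_cases him : i < m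
    · exact hind a (hsplit ▸ ha) i (Finset.mem_range.mpr him)
    · rw [hg0 i (not_lt.mp him), smul_zero]
  · rw [hcard, ← Finset.prod_range_mul_prod_Ico _ hm', Finset.prod_eq_one (s := Finset.Ico m m'),
      mul_one]
    intro i hi
    rw [hg0 i (Finset.mem_Ico.mp hi).1, addOrderOf_zero]

/-- **Independent generators** (the structure theorem `G ≃ ⊕ᵢ ℤ/nᵢ` read as a presentation):
a finite abelian group has a finite independent family `gᵢ` — `∑ aᵢ gᵢ = 0 ⟹ ord gᵢ ∣ aᵢ`
(McCallum 1991, Cor. 3.2: *"any relation `a₁c₁ + ⋯ + a_rc_r = 0` implies that `ord cᵢ` divides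
`aᵢ`"*) — which generates it: every `x` is `∑ aᵢ gᵢ`. [cite: McCallumLMS1991, Cor. 3.2 (independence), §5 p. 312] -/
theorem exists_indep_generators [Finite G] :
    ∃ (ι : Type) (_ : Fintype ι) (g : ι → G),
      (∀ a : ι → ℤ, ∑ i, a i • g i = 0 → ∀ i, (addOrderOf (g i) : ℤ) ∣ a i) ∧
      ∀ x : G, ∃ a : ι → ℤ, x = ∑ i, a i • g i := by
  classical
  obtain ⟨ι, _, p, hp, e, ⟨f⟩⟩ := AddCommGroup.equiv_directSum_zmod_of_finite G
  let f' : G ≃+ (Π i : ι, ZMod (p i ^ e i)) :=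
    f.trans (DirectSum.linearEquivFunOnFintype ℤ ι (fun i ↦ ZMod (p i ^ e i))).toAddEquiv
  haveI : ∀ i, NeZero (p i ^ e i) := fun i ↦ ⟨pow_ne_zero _ (hp i).ne_zero⟩
  let g : ι → G := fun i ↦ f'.symm (Pi.single i 1)
  have hg : ∀ i, f' (g i) = Pi.single i 1 := fun i ↦ AddEquiv.apply_symm_apply _ _
  have hord : ∀ i, addOrderOf (g i) = p i ^ e i := fun i ↦ by
    change addOrderOf (f'.symm (Pi.single i 1)) = _
    rw [AddEquiv.addOrderOf_eq]
    have := addOrderOf_injective (AddMonoidHom.single (fun i ↦ ZMod (p i ^ e i)) i)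
      (fun x y hxy ↦ Pi.single_injective (M := fun i ↦ ZMod (p i ^ e i)) i hxy) 1
    rwa [AddMonoidHom.single_apply, ZMod.addOrderOf_one] at this
  refine ⟨ι, inferInstance, g, fun a ha i ↦ ?_, fun x ↦ ?_⟩
  · have h1 : f' (∑ k, a k • g k) = 0 := by rw [ha, map_zero]
    rw [map_sum] at h1
    have h3 := congrFun h1 i
    rw [Finset.sum_apply, Pi.zero_apply, Finset.sum_eq_single_of_mem i (Finset.mem_univ i)] at h3
    · rw [map_zsmul, hg, Pi.smul_apply, Pi.single_eq_same, zsmul_one] at h3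
      rw [hord]
      exact (ZMod.intCast_zmod_eq_zero_iff_dvd (a i) (p i ^ e i)).mp h3
    · intro k _ hki
      rw [map_zsmul, hg, Pi.smul_apply, Pi.single_eq_of_ne (Ne.symm hki), smul_zero]
  · refine ⟨fun i ↦ ((f' x i).val : ℤ), ?_⟩
    apply f'.injective
    rw [map_sum]
    conv_lhs => rw [← Finset.univ_sum_single (f' x)]
    refine Finset.sum_congr rfl fun i _ ↦ ?_
    rw [map_zsmul, hg, ← Pi.single_smul, natCast_zsmul, nsmul_one, ZMod.natCast_zmod_val]

end Literature.GroupTheory.FiniteAbelian
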